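import Summits.Ventures.PercRepro.S1SevenSixRankFourSevenProfile

/-!
# PercRepro — THE SHAPE `(rank 3 on 6) ⊕ (rank 4 on 7)` OF THE `(7, 6)` CELL (p2, gen 28; SUBCLAIM-S1 §6.10
(xvii)(o); the `(7, 6)` capstone is `S1SevenSixSeparators`)

`M` coloop-free of rank `3` on `6` points, `N` coloop-free of rank `4` on `7` points, all pairs of rank `2`. With
`t` the rank-`2` triples of `N`, `q₂` its rank-`2` four-sets, `s₄`, `s₅` its spanning `4`- and `5`-sets:
`#U ≤ 6 N_N(4, 3) + 25 N_N(4, 2) + 140 ≤ 6 (35 − t) + 25 (s₅ + t) + 140`;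
`#Y ≥ 6 f_N(4) + 15 (f_N(3) + f_N(4)) + 23 (f_N(2) + f_N(3))` with `f_N(2) + f_N(3) ≥ 112 − s₄ − s₅`,
`f_N(3) + f_N(4) ≥ 99 − t − q₂`, `f_N(4) ≥ 8 + s₅ + s₄`; the incidence count `S1SevenSixTripleFour` gives
`s₄ ≤ 35 − 4t + 3q₂`, and `q₂ ≤ t`, `t + q₂ ≤ 21`: `Φ(7, 4) · #U ≤ #Y` with margin `≥ 11`.
Nothing is claimed about any cell.

* `consumer_arith_three_four_seven_six`, `c025_seven_four_disjointSum_three_four_seven` (the profile lemmas are in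
  `S1SevenSixRankFourSevenProfile`).
Axioms: standard.
-/

open scoped Matroid

namespace PercRepro

namespace S1

open Set

variable {α : Type}


/-- The arithmetic of the shape `(rank 3 on 6) ⊕ (rank 4 on 7)` at `(7, 4)`. -/
theorem consumer_arith_three_four_seven_six {u y t q2 W s4 s5 F2 F3 F4 : ℚ}
    (hU : u ≤ 6 * (35 - t) + 25 * (s5 + t) + 140)
    (hY : 6 * F4 + 15 * (F3 + F4) + 23 * (F2 + F3) ≤ y) (h23 : 112 ≤ F2 + F3 + s4 + s5)
    (h34 : 99 ≤ F3 + F4 + t + q2) (h4 : 8 + s5 + s4 ≤ F4) (hinc1 : 4 * t ≤ 4 * q2 + W) (hinc2 : 4 * q2 ≤ 4 * t)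
    (hpart : W + s4 + q2 ≤ 35) (hbig : t + q2 ≤ 21) (hs5 : s5 ≤ 21) : 14 / 5 * u ≤ y := by
  nlinarith

/-- **`M ⊕ N` at `(7, 4)`**: `M` coloop-free of rank `3` on `6` points and `N` coloop-free of rank `4` on `7` points,
both with all pairs of rank `2` — the shape `(rank 3 on 6) ⊕ (rank 4 on 7)` of the `(7, 6)` cell. -/
theorem c025_seven_four_disjointSum_three_four_seven (M N : Matroid α) [M.Finite] [N.Finite]
    (h : Disjoint M.E N.E) (hM : M.eRank = ((3 : ℕ) : ℕ∞)) (hME : M.E.ncard = 6) (hcolM : M.coloops = ∅)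
    (hpairsM : ∀ e ∈ M.E, ∀ f ∈ M.E, e ≠ f → M.eRk {e, f} = 2) (hN : N.eRank = ((4 : ℕ) : ℕ∞))
    (hNE : N.E.ncard = 7) (hcolN : N.coloops = ∅) (hpairsN : ∀ e ∈ N.E, ∀ f ∈ N.E, e ≠ f → N.eRk {e, f} = 2) :
    phiK 7 4 * ({A : Set α | A ⊆ (M.disjointSum N h).E ∧ (M.disjointSum N h).eRk A = ((7 : ℕ) : ℕ∞) ∧
        (M.disjointSum N h).eRk ((M.disjointSum N h).E \ A) = ((4 : ℕ) : ℕ∞)}.ncard : ℚ) ≤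
      ({A : Set α | A ⊆ (M.disjointSum N h).E ∧ ((4 : ℕ) : ℕ∞) < (M.disjointSum N h).eRk A ∧
        (M.disjointSum N h).eRk A < ((7 : ℕ) : ℕ∞)}.ncard : ℚ) := by
  -- the `U`-side: the slices `(1, 3)`, `(2, 2)`, `(3, 1)` (first index: `M`'s complement rank)
  have h43 := ncard_profileSet_four_three_le_rank_four_seven (N := N) hNE
  have h42 := ncard_profileSet_four_two_le_rank_four_seven (N := N) hNE
  have hU : {A : Set α | A ⊆ (M.disjointSum N h).E ∧ (M.disjointSum N h).eRk A = ((7 : ℕ) : ℕ∞) ∧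
      (M.disjointSum N h).eRk ((M.disjointSum N h).E \ A) = ((4 : ℕ) : ℕ∞)}.ncard ≤
      6 * (35 - (rankTwoTriples N).ncard) +
        25 * ({Q : Set α | Q ⊆ N.E ∧ Q.ncard = 5 ∧ N.eRk Q = ((4 : ℕ) : ℕ∞)}.ncard + (rankTwoTriples N).ncard) +
        140 := by
    rw [disjointSum_ncard_U_eq_finsum M N h 7 4, finsum_mem_coe_finset]
    have hsub : ({(3, 1), (3, 2), (3, 3)} : Finset (ℕ × ℕ)) ⊆ Finset.range (7 + 1) ×ˢ Finset.range (4 + 1) := by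
      decide
    rw [← Finset.sum_subset hsub ?_]
    · rw [Finset.sum_insert (by decide), Finset.sum_insert (by decide), Finset.sum_singleton]
      dsimp only
      show (profileSet M 3 1).ncard * (profileSet N 4 3).ncard + ((profileSet M 3 2).ncard * (profileSet N 4 2).ncard +
        (profileSet M 3 3).ncard * (profileSet N 4 1).ncard) ≤ _
      have h31 := ncard_profileSet_top_one_le_of_pairs' hpairsM 3
      rw [hME] at h31
      have hT := three_mul_ncard_rankTwoTriples_le hM hcolM hpairsM hME
      have h32 := ncard_profileSet_three_two_le_add (M := M) hME
      have h32' : (profileSet M 3 2).ncard ≤ 25 := by omega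
      have h33 := ncard_profileSet_le_choose_of_ncard_eq (N := M) (a := 3) (b := 3) hME
      rw [show Nat.choose (3 + 3) 3 = 20 by decide] at h33
      have g41 := ncard_profileSet_top_one_le_of_pairs' hpairsN 4
      rw [hNE] at g41
      have e1 := Nat.mul_le_mul h31 (show (profileSet N 4 3).ncard ≤ 35 - (rankTwoTriples N).ncard by omega)
      have e2 := Nat.mul_le_mul h32' h42
      have e3 := Nat.mul_le_mul h33 g41
      omega
    · rintro ⟨a, b⟩ hmem hnot
      rw [Finset.mem_product, Finset.mem_range, Finset.mem_range] at hmem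
      simp only [Finset.mem_insert, Finset.mem_singleton, Prod.mk.injEq, not_or] at hnot
      dsimp only
      rcases Nat.lt_or_ge 3 a with ha | ha
      · rw [profileSet_eq_empty_of_eRank_lt M hM ha b, ncard_empty, zero_mul]
      rcases Nat.lt_or_ge a 3 with ha' | ha'
      · have h7a : 4 < 7 - a := by omega
        rw [profileSet_eq_empty_of_eRank_lt N hN h7a (4 - b), ncard_empty, mul_zero]
      have ha3 : a = 3 := by omega
      subst ha3
      rw [show (7 : ℕ) - 3 = 4 from rfl]
      rcases Nat.lt_or_ge b 1 with hb | hb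
      · have hb0 : b = 0 := by omega
        subst hb0
        -- `N_N(4, 4) = ∅` on `7` points
        rw [profileSet_eq_empty_of_ncard_lt N (by rw [hNE]; norm_num : N.E.ncard < 4 + (4 - 0)), ncard_empty,
          mul_zero]
      · have hb4 : 3 < b := by omega
        rw [profileSet_eq_empty_of_eRank_lt_snd M hM hb4 3, ncard_empty, zero_mul]
  -- the `Y`-side
  have hY : 6 * (rankSet N 4).ncard + 15 * ((rankSet N 3).ncard + (rankSet N 4).ncard) +
      23 * ((rankSet N 2).ncard + (rankSet N 3).ncard) ≤
      {A : Set α | A ⊆ (M.disjointSum N h).E ∧ ((4 : ℕ) : ℕ∞) < (M.disjointSum N h).eRk A ∧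
        (M.disjointSum N h).eRk A < ((7 : ℕ) : ℕ∞)}.ncard := by
    rw [disjointSum_ncard_Y_eq_finsum M N h 7 4, finsum_mem_coe_finset]
    have hsub : ({(1, 4), (2, 3), (2, 4), (3, 2), (3, 3)} : Finset (ℕ × ℕ)) ⊆
        (Finset.range 7 ×ˢ Finset.range 7).filter (fun x : ℕ × ℕ => 4 < x.1 + x.2 ∧ x.1 + x.2 < 7) := by
      decide
    refine le_trans ?_ (Finset.sum_le_sum_of_subset hsub)
    rw [Finset.sum_insert (by decide), Finset.sum_insert (by decide), Finset.sum_insert (by decide),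
      Finset.sum_insert (by decide), Finset.sum_singleton]
    dsimp only
    have F3 := ncard_rankSet_three_ge_of_pairs hM hcolM hpairsM hME
    have F2 : 15 ≤ (rankSet M 2).ncard := by
      have := choose_le_ncard_rankSet_two_of_pairs hpairsM
      rwa [hME, show Nat.choose 6 2 = 15 by decide] at this
    have F1 : 6 ≤ (rankSet M 1).ncard := by
      have := ncard_le_ncard_rankSet_one_of_pairs hpairsM (by omega)
      rwa [hME] at this
    have e14 := Nat.mul_le_mul_right (rankSet N 4).ncard F1
    have e23 := Nat.mul_le_mul_right (rankSet N 3).ncard F2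
    have e24 := Nat.mul_le_mul_right (rankSet N 4).ncard F2
    have e32 := Nat.mul_le_mul_right (rankSet N 2).ncard F3
    have e33 := Nat.mul_le_mul_right (rankSet N 3).ncard F3
    linarith
  -- the profile of `N` and the incidence count
  have h23 := ncard_rankSet_two_add_three_add_spanning_ge_rank_four_seven hN hNE hcolN hpairsN
  have h34 := ncard_rankSet_three_add_four_add_rankTwo_ge_rank_four_seven hN hNE hcolN hpairsN
  have h4 := ncard_rankSet_four_ge_rank_four_seven hN hNE hcolN
  have hinc1 := ncard_tripleFourSets_le N hpairsN
  have hinc2 := four_mul_ncard_rankTwo_four_le N hpairsN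
  have hinceq := ncard_tripleFourSets_eq N hNE
  rw [hinceq] at hinc1 hinc2
  have hbig := ncard_rankTwoTriples_add_rankTwo_four_le_rank_four_seven hN hNE hcolN hpairsN
  -- `W + s₄ + q₂ ≤ 35`: three disjoint families of `4`-sets
  have hpart : {Q : Set α | Q ⊆ N.E ∧ Q.ncard = 4 ∧ N.eRk Q ≠ 2 ∧ ∃ T ∈ rankTwoTriples N, T ⊆ Q}.ncard +
      {Q : Set α | Q ⊆ N.E ∧ Q.ncard = 4 ∧ N.eRk Q = ((4 : ℕ) : ℕ∞)}.ncard +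
      {Q : Set α | Q ⊆ N.E ∧ Q.ncard = 4 ∧ N.eRk Q = 2}.ncard ≤ 35 := by
    have hf4 : {A : Set α | A ⊆ N.E ∧ A.ncard = 4}.Finite := N.ground_finite.finite_subsets.subset (fun _ hA => hA.1)
    have hW : {Q : Set α | Q ⊆ N.E ∧ Q.ncard = 4 ∧ N.eRk Q ≠ 2 ∧ ∃ T ∈ rankTwoTriples N, T ⊆ Q}.Finite :=
      hf4.subset (fun _ hA => ⟨hA.1, hA.2.1⟩)
    have hS : {Q : Set α | Q ⊆ N.E ∧ Q.ncard = 4 ∧ N.eRk Q = ((4 : ℕ) : ℕ∞)}.Finite :=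
      hf4.subset (fun _ hA => ⟨hA.1, hA.2.1⟩)
    have hQ : {Q : Set α | Q ⊆ N.E ∧ Q.ncard = 4 ∧ N.eRk Q = 2}.Finite := hf4.subset (fun _ hA => ⟨hA.1, hA.2.1⟩)
    have hsub : {Q : Set α | Q ⊆ N.E ∧ Q.ncard = 4 ∧ N.eRk Q ≠ 2 ∧ ∃ T ∈ rankTwoTriples N, T ⊆ Q} ∪
        {Q : Set α | Q ⊆ N.E ∧ Q.ncard = 4 ∧ N.eRk Q = ((4 : ℕ) : ℕ∞)} ∪
        {Q : Set α | Q ⊆ N.E ∧ Q.ncard = 4 ∧ N.eRk Q = 2} ⊆ {A : Set α | A ⊆ N.E ∧ A.ncard = 4} := by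
      rintro A ((⟨hAE, h4, -⟩ | ⟨hAE, h4, -⟩) | ⟨hAE, h4, -⟩) <;> exact ⟨hAE, h4⟩
    have hd1 : Disjoint {Q : Set α | Q ⊆ N.E ∧ Q.ncard = 4 ∧ N.eRk Q ≠ 2 ∧ ∃ T ∈ rankTwoTriples N, T ⊆ Q}
        {Q : Set α | Q ⊆ N.E ∧ Q.ncard = 4 ∧ N.eRk Q = ((4 : ℕ) : ℕ∞)} := by
      rw [Set.disjoint_left]
      rintro A ⟨hAE, hA4, -, T, hT, hTA⟩ ⟨-, -, h4⟩
      -- a `4`-set containing a rank-`2` triple is `insert x T`, of rank `≤ 3`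
      have hAfin : A.Finite := N.ground_finite.subset hAE
      have h1 : (A \ T).ncard = 1 := by rw [ncard_sdiff' hTA hAfin, hA4, hT.2.1]
      obtain ⟨x, hx⟩ := ncard_eq_one.mp h1
      have hxmem : x ∈ A \ T := by rw [hx]; exact mem_singleton x
      have hAeq : A = insert x T := by
        ext w
        constructor
        · intro hw
          by_cases hwT : w ∈ T
          · exact Or.inr hwT
          · have : w ∈ A \ T := ⟨hw, hwT⟩
            rw [hx] at this
            exact Or.inl this
        · rintro (rfl | hw)
          · exact hxmem.1
          · exact hTA hw
      have hle : N.eRk A ≤ N.eRk T + 1 := by rw [hAeq]; exact N.eRk_insert_le_add_one x T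
      rw [h4, hT.2.2] at hle
      exact absurd hle (by decide)
    have hd2 : Disjoint ({Q : Set α | Q ⊆ N.E ∧ Q.ncard = 4 ∧ N.eRk Q ≠ 2 ∧ ∃ T ∈ rankTwoTriples N, T ⊆ Q} ∪
        {Q : Set α | Q ⊆ N.E ∧ Q.ncard = 4 ∧ N.eRk Q = ((4 : ℕ) : ℕ∞)})
        {Q : Set α | Q ⊆ N.E ∧ Q.ncard = 4 ∧ N.eRk Q = 2} := by
      rw [Set.disjoint_left]
      rintro A (⟨-, -, hne, -⟩ | ⟨-, -, h4⟩) ⟨-, -, h2⟩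
      · exact hne h2
      · rw [h4] at h2; exact absurd h2 (by decide)
    have h := ncard_le_ncard hsub hf4
    rwa [ncard_union_eq hd2 (hW.union hS) hQ, ncard_union_eq hd1 hW hS, ncard_setOf_subset_ncard_eq N.ground_finite 4,
      hNE, show Nat.choose 7 4 = 35 by decide] at h
  have hs5 : {Q : Set α | Q ⊆ N.E ∧ Q.ncard = 5 ∧ N.eRk Q = ((4 : ℕ) : ℕ∞)}.ncard ≤ 21 := by
    have hf5 : {A : Set α | A ⊆ N.E ∧ A.ncard = 5}.Finite := N.ground_finite.finite_subsets.subset (fun _ hA => hA.1)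
    have := ncard_le_ncard (show {Q : Set α | Q ⊆ N.E ∧ Q.ncard = 5 ∧ N.eRk Q = ((4 : ℕ) : ℕ∞)} ⊆
      {A : Set α | A ⊆ N.E ∧ A.ncard = 5} from fun A hA => ⟨hA.1, hA.2.1⟩) hf5
    rwa [ncard_setOf_subset_ncard_eq N.ground_finite 5, hNE, show Nat.choose 7 5 = 21 by decide] at this
  rw [phiK_seven_four]
  have hU' : (({A : Set α | A ⊆ (M.disjointSum N h).E ∧ (M.disjointSum N h).eRk A = ((7 : ℕ) : ℕ∞) ∧
      (M.disjointSum N h).eRk ((M.disjointSum N h).E \ A) = ((4 : ℕ) : ℕ∞)}.ncard : ℕ) : ℚ) ≤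
      6 * (35 - ((rankTwoTriples N).ncard : ℚ)) +
        25 * (({Q : Set α | Q ⊆ N.E ∧ Q.ncard = 5 ∧ N.eRk Q = ((4 : ℕ) : ℕ∞)}.ncard : ℚ) +
          ((rankTwoTriples N).ncard : ℚ)) + 140 := by
    have hcast : ((6 * (35 - (rankTwoTriples N).ncard) +
        25 * ({Q : Set α | Q ⊆ N.E ∧ Q.ncard = 5 ∧ N.eRk Q = ((4 : ℕ) : ℕ∞)}.ncard + (rankTwoTriples N).ncard) +
        140 : ℕ) : ℚ) = 6 * (35 - ((rankTwoTriples N).ncard : ℚ)) +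
        25 * (({Q : Set α | Q ⊆ N.E ∧ Q.ncard = 5 ∧ N.eRk Q = ((4 : ℕ) : ℕ∞)}.ncard : ℚ) +
          ((rankTwoTriples N).ncard : ℚ)) + 140 := by
      have : (rankTwoTriples N).ncard ≤ 35 := by omega
      push_cast [Nat.cast_sub this]
      ring
    rw [← hcast]
    exact_mod_cast hU
  have hY' : 6 * ((rankSet N 4).ncard : ℚ) + 15 * (((rankSet N 3).ncard : ℚ) + ((rankSet N 4).ncard : ℚ)) +
      23 * (((rankSet N 2).ncard : ℚ) + ((rankSet N 3).ncard : ℚ)) ≤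
      (({A : Set α | A ⊆ (M.disjointSum N h).E ∧ ((4 : ℕ) : ℕ∞) < (M.disjointSum N h).eRk A ∧
        (M.disjointSum N h).eRk A < ((7 : ℕ) : ℕ∞)}.ncard : ℕ) : ℚ) := by
    exact_mod_cast hY
  exact consumer_arith_three_four_seven_six
    (q2 := (({Q : Set α | Q ⊆ N.E ∧ Q.ncard = 4 ∧ N.eRk Q = 2}.ncard : ℕ) : ℚ))
    (W := (({Q : Set α | Q ⊆ N.E ∧ Q.ncard = 4 ∧ N.eRk Q ≠ 2 ∧ ∃ T ∈ rankTwoTriples N, T ⊆ Q}.ncard : ℕ) : ℚ))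
    (s4 := (({Q : Set α | Q ⊆ N.E ∧ Q.ncard = 4 ∧ N.eRk Q = ((4 : ℕ) : ℕ∞)}.ncard : ℕ) : ℚ))
    hU' hY' (by exact_mod_cast h23) (by exact_mod_cast h34)
    (by exact_mod_cast h4) (by exact_mod_cast hinc1) (by exact_mod_cast hinc2) (by exact_mod_cast hpart)
    (by exact_mod_cast hbig) (by exact_mod_cast hs5)

end S1

end PercRepro
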